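import Literature.Barriers.CriticalPhenomena.GaussianDominationRouteDiagramsProp74Events
import Literature.Barriers.CriticalPhenomena.GaussianDominationRouteDiagramsProp74Algebra
import HarnessLib

/-!
# Proof of `HvdH2017_prop74` (Heydenreich–van der Hofstad, Prop. 7.4: the diagrammatic estimates
# on `Π^{(N)}`, `N ≥ 1`)

Sibling proof file of `GaussianDominationRouteDiagrams.lean`, which vendors Prop. 7.4 of
Heydenreich–van der Hofstad (2017) as the named fact `HvdH2017_prop74`: for `d ≥ 2`, `p < p_c`,
`N ≥ 1`, `Σ_x Π^{(N)}(x) ≤ Δ_p (2Δ̃_pΔ_p)^N` (7.5.3) and `Σ_x [1 - cos(k·x)] Π^{(N)}(x) ≤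
(2N+1)[Δ_p W_p(k) (2Δ̃_p + [1+2dp] N Δ_p)(2Δ̃_pΔ_p)^{N-1} + (N-1)(Δ̃_p² W_p(k) + H_p(k)) Δ_p²
(2Δ̃_pΔ_p)^{N-2}]` (7.5.4). This file PROVES it (`HvdH2017_prop74_holds`), assembling

* `…Prop74Events.lean` (the events of §7.3, BK, the nested Tonelli bound `lacePiT_succ_le` on
  `Π̃^{(n+1)} = 𝒩^{n+1} kerE` in terms of the recursive kernel bound `gK n`), and
* `…Prop74Algebra.lean` (the `ℝ≥0∞` diagram algebra of §7.4–§7.5 over an abelian group: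
  `tsum_chainN_le_closed` = (7.5.3) and `tsum_cos_chainN_le_closed` = (7.5.4) for the right-hand
  side `chainN n` of (7.4.10)):

1. `tsum_bondJ_mul_phiK`, `tsum_bondJ_mul_gK_eq`, `lacePiT_succ_le_chainN` — the `J`-sums of
   (7.3.11) performed (`Σ_v J(u,v) τ_p(t-v) = τ̃_p(t-u)`), recognising `B₁, B₂ = B₂⁽¹⁾ + B₂⁽²⁾, A₃`
   of (7.4.2)–(7.4.4): `Π̃^{(n+1)}(x) ≤ chainN τ_p τ̃_p n x`, i.e. **(7.4.10)**;
2. the hypotheses of the algebra on `ℤ^d`: Lemma 7.3 for lists (`cosW_list_sum_le`, from the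
   tree's `HvdH2017_lemma73`), `τ̃_p = J ⋆ τ_p` (`tauTildeE_eq_tsum`), `ΣJ ≤ 2dp`, and the
   identification of the abstract `H`-diagram with `hDiagAt` together with the bound
   `hDiagAt ≤ hDiag` (`Hat_tauE_eq_ofReal_hDiagAt`, `hDiagAt_le_hDiag`; this needs
   `H_p(a₁,a₂;k) < ∞` for `p < p_c`, proved crudely as `≤ 2(2dp)²χ(p)⁵`, `Hat_tauE_le`);
3. the conversion of the two `ℝ≥0∞` bounds to the real statement (all diagrams are `ofReal` of
   the real ones for `p < p_c`: `convE_convE_tauE_eq_triangleAt`, `…TildeAt`, `convE_cosW_eq_wDiagAt`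
   of `…DiagramsProofs.lean`), with `N = n + 1`.

## References

* M. Heydenreich, R. van der Hofstad, *Progress in High-Dimensional Percolation and Random
  Graphs* (Springer 2017): Prop. 7.4 ((7.5.3)–(7.5.4)), §7.3 ((7.3.8)–(7.3.11)), §7.4
  ((7.4.1)–(7.4.10)), §7.5 ((7.5.1)–(7.5.29), Exercise 7.5), Lemma 7.3, (7.2.3), (6.2.1), (6.2.27).
* M. Aizenman, C. M. Newman, J. Stat. Phys. 36 (1984) 107–143 (`χ(p) < ∞` for `p < p_c`, used
  through the tree's `summable_tau_of_lt_criticalProb`).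
-/

noncomputable section

namespace Literature.Barriers.CriticalPhenomena

open MeasureTheory Literature.Probability.LatticeModels Literature.Probability.Percolation DiagramAlgebra
open SpreadOutIsing (latticeConv)
open scoped ENNReal NNReal

variable {d : ℕ}

/-! ### From the nested bound `g_n` to the chain (7.4.10): performing the `J`-sums -/

section Chain

/-- **(7.4.7)–(7.4.9) after the `J`-sum**: `Σ_v J(u,v) τ(z-w) φ(v,z,u',z') =
Σ_{t,w'} B₁(w,u,z,t) B₂(z,t,w',u') τ(z'-w')` (`Σ_v J(u,v) τ_p(t-v) = τ̃_p(t-u)`; the `F''` term is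
the `B₂⁽²⁾` term with its Kronecker delta). [cite: HeydenreichVanDerHofstad2017, (7.4.7)–(7.4.9)] -/
theorem tsum_bondJ_mul_phiK (p : unitInterval) (w u z u' z' : Site d) :
    ∑' v, ENNReal.ofReal (bondJ d p (v - u)) * (tauE d p (z - w) * phiK d p v z u' z') =
      ∑' t, ∑' w', kB1 (tauE d p) (tauTildeE d p) (w, u) (z, t) *
        kB2 (tauE d p) (z, t) (w', u') * tauE d p (z' - w') := by
  classical
  set T := tauE d p with hT
  set Tt := tauTildeE d p with hTt
  set Jf : Site d → ℝ≥0∞ := fun v => ENNReal.ofReal (bondJ d p (v - u)) with hJf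
  have hJ : ∀ t, ∑' v, Jf v * T (t - v) = Tt (t - u) := fun t => tsum_bondJ_mul_tauE p u t
  -- the two parts of the left-hand side
  have lhs : ∑' v, Jf v * (T (z - w) * phiK d p v z u' z') =
      (∑' t, ∑' w'', Tt (t - u) * T (z - w) * (T (z - t) * T (w'' - t) * T (u' - z) * T (u' - w'') *
          T (z' - w''))) +
        ∑' w'', Tt (w'' - u) * T (z - w) * (T (u' - z) * triV T w'' z u' * T (z' - w'')) := by
    calc ∑' v, Jf v * (T (z - w) * phiK d p v z u' z')
        = ∑' v, ∑' t, ∑' w'', Jf v * (T (z - w) * (wF' d p v z u' z' t w'' + wF'' d p v z u' z' t w'')) := by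
          refine tsum_congr fun v => ?_
          rw [phiK_def, ← ENNReal.tsum_mul_left, ← ENNReal.tsum_mul_left]
          refine tsum_congr fun t => ?_
          rw [← ENNReal.tsum_mul_left, ← ENNReal.tsum_mul_left]
      _ = ∑' t, ∑' w'', ∑' v, Jf v * (T (z - w) * (wF' d p v z u' z' t w'' + wF'' d p v z u' z' t w'')) := by
          rw [ENNReal.tsum_comm]
          exact tsum_congr fun t => ENNReal.tsum_comm
      _ = ∑' t, ∑' w'', ((∑' v, Jf v * T (t - v)) * (T (z - w) * (T (z - t) * T (w'' - t) * T (u' - z) *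
            T (u' - w'') * T (z' - w''))) +
          (∑' v, Jf v * T (w'' - v)) * (T (z - w) * (T (t - w'') * T (z - t) * T (u' - t) * T (u' - z) *
            T (z' - w'')))) := by
          refine tsum_congr fun t => tsum_congr fun w'' => ?_
          rw [← ENNReal.tsum_mul_right, ← ENNReal.tsum_mul_right, ← ENNReal.tsum_add]
          exact tsum_congr fun v => by rw [wF'_def, wF''_def, hT]; ring
      _ = ∑' t, ∑' w'', (Tt (t - u) * T (z - w) * (T (z - t) * T (w'' - t) * T (u' - z) * T (u' - w'') *
            T (z' - w'')) +
          Tt (w'' - u) * T (z - w) * (T (u' - z) * T (z' - w'')) * (T (t - w'') * T (z - t) * T (u' - t))) := by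
          refine tsum_congr fun t => tsum_congr fun w'' => ?_
          rw [hJ, hJ]; ring
      _ = (∑' t, ∑' w'', Tt (t - u) * T (z - w) * (T (z - t) * T (w'' - t) * T (u' - z) * T (u' - w'') *
            T (z' - w''))) +
          ∑' t, ∑' w'', Tt (w'' - u) * T (z - w) * (T (u' - z) * T (z' - w'')) *
            (T (t - w'') * T (z - t) * T (u' - t)) := tsum₂_add_site _ _
      _ = _ := by
          congr 1
          rw [ENNReal.tsum_comm]
          refine tsum_congr fun w'' => ?_
          rw [ENNReal.tsum_mul_left, triV_def]
          ring
  -- the two parts of the right-hand side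
  have rhs : ∑' t, ∑' w', kB1 T Tt (w, u) (z, t) * kB2 T (z, t) (w', u') * T (z' - w') =
      (∑' t, ∑' w'', Tt (t - u) * T (z - w) * (T (z - t) * T (w'' - t) * T (u' - z) * T (u' - w'') *
          T (z' - w''))) +
        ∑' w'', Tt (w'' - u) * T (z - w) * (T (u' - z) * triV T w'' z u' * T (z' - w'')) := by
    have e : ∀ t w'', kB1 T Tt (w, u) (z, t) * kB2 T (z, t) (w'', u') * T (z' - w'') =
        Tt (t - u) * T (z - w) * (T (z - t) * T (w'' - t) * T (u' - z) * T (u' - w'') * T (z' - w'')) +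
          (if t = w'' then 1 else 0) * (Tt (t - u) * T (z - w) * (T (u' - z) * triV T w'' z u' *
            T (z' - w''))) := by
      intro t w''
      have hs : T (t - z) = T (z - t) := by rw [hT, ← tauE_neg p (t - z), neg_sub]
      simp only [kB1_def, kB2_def, B1_def, B2_def, B21_def, B22_def]
      rw [hs]
      ring
    rw [show (∑' t, ∑' w', kB1 T Tt (w, u) (z, t) * kB2 T (z, t) (w', u') * T (z' - w')) =
        ∑' t, ∑' w'', (Tt (t - u) * T (z - w) * (T (z - t) * T (w'' - t) * T (u' - z) * T (u' - w'') *
            T (z' - w'')) +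
          (if t = w'' then 1 else 0) * (Tt (t - u) * T (z - w) * (T (u' - z) * triV T w'' z u' *
            T (z' - w'')))) from tsum_congr fun t => tsum_congr fun w'' => e t w'', tsum₂_add_site]
    congr 1
    rw [ENNReal.tsum_comm]
    exact tsum_congr fun w'' => tsum_delta_left w'' fun t =>
      Tt (t - u) * T (z - w) * (T (u' - z) * triV T w'' z u' * T (z' - w''))
  rw [lhs, rhs]
where
  /-- Linearity of a double `tsum` over `ℤ^d` (sum). [folklore] -/
  tsum₂_add_site (f g : Site d → Site d → ℝ≥0∞) :
      ∑' a, ∑' b, (f a b + g a b) = (∑' a, ∑' b, f a b) + ∑' a, ∑' b, g a b := by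
    rw [← ENNReal.tsum_add]
    exact tsum_congr fun a => ENNReal.tsum_add

/-- **The `J`-sums of (7.3.11) performed**: `Σ_v J(u,v) τ(z-w) g_n(v,z,x) = Σ_t B₁(w,u,z,t) Θ_n((z,t),x)`,
i.e. the nested bound of `…Prop74Events.lean` IS the chain `B₁(B₂B₁)ⁿA₃` of (7.4.10).
[cite: HeydenreichVanDerHofstad2017, (7.3.11) and (7.4.5)–(7.4.10)] -/
theorem tsum_bondJ_mul_gK_eq (p : unitInterval) : ∀ (n : ℕ) (w u z x : Site d),
    ∑' v, ENNReal.ofReal (bondJ d p (v - u)) * (tauE d p (z - w) * gK d p n v z x) =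
      ∑' t, kB1 (tauE d p) (tauTildeE d p) (w, u) (z, t) * DiagramAlgebra.theta (tauE d p) (tauTildeE d p) n x (z, t)
  | 0, w, u, z, x => by
    calc ∑' v, ENNReal.ofReal (bondJ d p (v - u)) * (tauE d p (z - w) * gK d p 0 v z x)
        = ∑' v, ∑' t, ENNReal.ofReal (bondJ d p (v - u)) * (tauE d p (z - w) *
            (tauE d p (t - v) * tauE d p (z - t) * tauE d p (x - t) * tauE d p (x - z))) := by
          refine tsum_congr fun v => ?_
          rw [gK_zero, ← ENNReal.tsum_mul_left, ← ENNReal.tsum_mul_left]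
      _ = ∑' t, ∑' v, ENNReal.ofReal (bondJ d p (v - u)) * (tauE d p (z - w) *
            (tauE d p (t - v) * tauE d p (z - t) * tauE d p (x - t) * tauE d p (x - z))) := ENNReal.tsum_comm
      _ = ∑' t, (∑' v, ENNReal.ofReal (bondJ d p (v - u)) * tauE d p (t - v)) *
            (tauE d p (z - w) * (tauE d p (z - t) * tauE d p (x - t) * tauE d p (x - z))) := by
          refine tsum_congr fun t => ?_
          rw [← ENNReal.tsum_mul_right]
          exact tsum_congr fun v => by ring
      _ = _ := by
          refine tsum_congr fun t => ?_
          rw [tsum_bondJ_mul_tauE, theta_zero, kB1_def, B1_def, A3_def, ← tauE_neg p (z - t), neg_sub]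
          ring
  | n + 1, w, u, z, x => by
    set T := tauE d p with hT
    set Tt := tauTildeE d p with hTt
    set J : Site d → Site d → ℝ≥0∞ := fun u v => ENNReal.ofReal (bondJ d p (v - u)) with hJ
    have ih : ∀ w' u' z', ∑' v', J u' v' * (T (z' - w') * gK d p n v' z' x) =
        ∑' t', kB1 T Tt (w', u') (z', t') * DiagramAlgebra.theta T Tt n x (z', t') :=
      fun w' u' z' => tsum_bondJ_mul_gK_eq p n w' u' z' x
    set Φ : Site d → Site d → Site d → Site d → Site d → ℝ≥0∞ := fun u' v' z' t w' =>
      kB1 T Tt (w, u) (z, t) * kB2 T (z, t) (w', u') * (J u' v' * (T (z' - w') * gK d p n v' z' x)) with hΦ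
    calc ∑' v, J u v * (T (z - w) * gK d p (n + 1) v z x)
        = ∑' v, ∑' u', ∑' v', ∑' z', J u v * (T (z - w) * phiK d p v z u' z') *
            (J u' v' * gK d p n v' z' x) := by
          refine tsum_congr fun v => ?_
          rw [gK_succ p n v z x, ENNReal.tsum_prod', ← mul_assoc, ← ENNReal.tsum_mul_left]
          refine tsum_congr fun u' => ?_
          rw [← ENNReal.tsum_mul_left]
          refine tsum_congr fun v' => ?_
          dsimp only
          rw [← ENNReal.tsum_mul_left, ← ENNReal.tsum_mul_left]
          exact tsum_congr fun z' => by simp only [hJ]; ring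
      _ = ∑' u', ∑' v', ∑' z', ∑' v, J u v * (T (z - w) * phiK d p v z u' z') *
            (J u' v' * gK d p n v' z' x) := by
          rw [ENNReal.tsum_comm]
          refine tsum_congr fun u' => ?_
          rw [ENNReal.tsum_comm]
          refine tsum_congr fun v' => ?_
          rw [ENNReal.tsum_comm]
      _ = ∑' u', ∑' v', ∑' z', (∑' t, ∑' w', kB1 T Tt (w, u) (z, t) * kB2 T (z, t) (w', u') *
            T (z' - w')) * (J u' v' * gK d p n v' z' x) := by
          refine tsum_congr fun u' => tsum_congr fun v' => tsum_congr fun z' => ?_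
          rw [ENNReal.tsum_mul_right, hJ, hT, hTt, tsum_bondJ_mul_phiK p w u z u' z']
      _ = ∑' u', ∑' v', ∑' z', ∑' t, ∑' w', Φ u' v' z' t w' := by
          refine tsum_congr fun u' => tsum_congr fun v' => tsum_congr fun z' => ?_
          rw [← ENNReal.tsum_mul_right]
          refine tsum_congr fun t => ?_
          rw [← ENNReal.tsum_mul_right]
          exact tsum_congr fun w' => by rw [hΦ]; ring
      _ = ∑' t, ∑' w', ∑' u', ∑' z', ∑' v', Φ u' v' z' t w' := by
          calc ∑' u', ∑' v', ∑' z', ∑' t, ∑' w', Φ u' v' z' t w'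
              = ∑' u', ∑' z', ∑' v', ∑' t, ∑' w', Φ u' v' z' t w' := tsum_congr fun u' => ENNReal.tsum_comm
            _ = ∑' u', ∑' z', ∑' t, ∑' v', ∑' w', Φ u' v' z' t w' :=
                tsum_congr fun u' => tsum_congr fun z' => ENNReal.tsum_comm
            _ = ∑' u', ∑' z', ∑' t, ∑' w', ∑' v', Φ u' v' z' t w' :=
                tsum_congr fun u' => tsum_congr fun z' => tsum_congr fun t => ENNReal.tsum_comm
            _ = ∑' u', ∑' t, ∑' z', ∑' w', ∑' v', Φ u' v' z' t w' := tsum_congr fun u' => ENNReal.tsum_comm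
            _ = ∑' u', ∑' t, ∑' w', ∑' z', ∑' v', Φ u' v' z' t w' :=
                tsum_congr fun u' => tsum_congr fun t => ENNReal.tsum_comm
            _ = ∑' t, ∑' u', ∑' w', ∑' z', ∑' v', Φ u' v' z' t w' := ENNReal.tsum_comm
            _ = ∑' t, ∑' w', ∑' u', ∑' z', ∑' v', Φ u' v' z' t w' := tsum_congr fun t => ENNReal.tsum_comm
      _ = ∑' t, kB1 T Tt (w, u) (z, t) * ∑' w', ∑' u', kB2 T (z, t) (w', u') *
            ∑' z', ∑' v', J u' v' * (T (z' - w') * gK d p n v' z' x) := by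
          refine tsum_congr fun t => ?_
          rw [← ENNReal.tsum_mul_left]
          refine tsum_congr fun w' => ?_
          rw [← ENNReal.tsum_mul_left]
          refine tsum_congr fun u' => ?_
          rw [← ENNReal.tsum_mul_left, ← ENNReal.tsum_mul_left]
          refine tsum_congr fun z' => ?_
          rw [← ENNReal.tsum_mul_left, ← ENNReal.tsum_mul_left]
          exact tsum_congr fun v' => by simp only [hΦ]; ring
      _ = ∑' t, kB1 T Tt (w, u) (z, t) * ∑' w', ∑' u', kB2 T (z, t) (w', u') *
            ∑' z', ∑' t', kB1 T Tt (w', u') (z', t') * DiagramAlgebra.theta T Tt n x (z', t') := by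
          refine tsum_congr fun t => ?_
          congr 1
          exact tsum_congr fun w' => tsum_congr fun u' => by
            congr 1
            exact tsum_congr fun z' => ih w' u' z'
      _ = ∑' t, kB1 T Tt (w, u) (z, t) * DiagramAlgebra.theta T Tt (n + 1) x (z, t) := by
          refine tsum_congr fun t => ?_
          rw [theta_succ, ENNReal.tsum_prod']
          congr 1
          exact tsum_congr fun w' => tsum_congr fun u' => by rw [ENNReal.tsum_prod']

/-- **(7.4.10) for `Π^{(n+1)}`** (in `ℝ≥0∞`, every `p`): `Π̃^{(n+1)}(x) ≤ Σ_{(w,u)} A₃(0,u,w)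
Σ_{(z,t)} B₁(w,u,z,t) [(B₂B₁)ⁿ A₃]((z,t),x)` with `τ = τ_p`, `τ̃ = τ̃_p`.
[cite: HeydenreichVanDerHofstad2017, (7.4.10)] -/
theorem lacePiT_succ_le_chainN (p : unitInterval) (n : ℕ) (x : Site d) :
    lacePiT d p (n + 1) x ≤ chainN (tauE d p) (tauTildeE d p) n x := by
  refine (lacePiT_succ_le p n x).trans (le_of_eq ?_)
  set T := tauE d p with hT
  set Tt := tauTildeE d p with hTt
  calc ∑' b : Site d × Site d, ENNReal.ofReal (bondJ d p (b.2 - b.1)) *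
        ∑' z', (∑' w, T b.1 * T w * T (b.1 - w) * T (z' - w)) * gK d p n b.2 z' x
      = ∑' u, ∑' v, ∑' z', ∑' w, T u * T w * T (u - w) *
          (ENNReal.ofReal (bondJ d p (v - u)) * (T (z' - w) * gK d p n v z' x)) := by
        rw [ENNReal.tsum_prod']
        refine tsum_congr fun u => tsum_congr fun v => ?_
        dsimp only
        rw [← ENNReal.tsum_mul_left]
        refine tsum_congr fun z' => ?_
        rw [← ENNReal.tsum_mul_right, ← ENNReal.tsum_mul_left]
        exact tsum_congr fun w => by ring
    _ = ∑' u, ∑' w, ∑' z', ∑' v, T u * T w * T (u - w) *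
          (ENNReal.ofReal (bondJ d p (v - u)) * (T (z' - w) * gK d p n v z' x)) := by
        refine tsum_congr fun u => ?_
        calc _ = ∑' v, ∑' w, ∑' z', T u * T w * T (u - w) *
              (ENNReal.ofReal (bondJ d p (v - u)) * (T (z' - w) * gK d p n v z' x)) :=
              tsum_congr fun v => ENNReal.tsum_comm
          _ = ∑' w, ∑' v, ∑' z', T u * T w * T (u - w) *
              (ENNReal.ofReal (bondJ d p (v - u)) * (T (z' - w) * gK d p n v z' x)) := ENNReal.tsum_comm
          _ = _ := tsum_congr fun w => ENNReal.tsum_comm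
    _ = ∑' u, ∑' w, T u * T w * T (u - w) *
          ∑' z', ∑' t, kB1 T Tt (w, u) (z', t) * DiagramAlgebra.theta T Tt n x (z', t) := by
        refine tsum_congr fun u => tsum_congr fun w => ?_
        rw [← ENNReal.tsum_mul_left]
        refine tsum_congr fun z' => ?_
        rw [ENNReal.tsum_mul_left, hT, hTt, tsum_bondJ_mul_gK_eq p n w u z' x]
    _ = chainN T Tt n x := by
        rw [chainN_def, ENNReal.tsum_prod', ENNReal.tsum_comm]
        refine tsum_congr fun w => tsum_congr fun u => ?_
        rw [sA3_def, ENNReal.tsum_prod']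

end Chain


/-! ### The hypotheses of the abstract diagram algebra on `ℤ^d` -/

section Hyps

/-- `k·(Σ L) = Σ_{a ∈ L} k·a`. [folklore] -/
theorem kdot_list_sum (k : Fin d → ℝ) : ∀ L : List (Site d), kdot k L.sum = (L.map (kdot k)).sum
  | [] => by simp
  | a :: L => by rw [List.sum_cons, kdot_add, List.map_cons, List.sum_cons, kdot_list_sum k L]

/-- **Lemma 7.3 for a list**: `1 - cos(Σ L) ≤ |L| Σ_{t ∈ L} [1 - cos t]`.
[cite: HeydenreichVanDerHofstad2017, Lemma 7.3 (7.2.16)] -/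
theorem one_sub_cos_list_sum_le (L : List ℝ) :
    1 - Real.cos L.sum ≤ L.length * (L.map fun t => 1 - Real.cos t).sum := by
  have h := HvdH2017_lemma73 (Finset.univ : Finset (Fin L.length)) (fun i => L.get i)
  have e1 : (∑ i : Fin L.length, L.get i) = L.sum := by rw [← List.sum_ofFn, List.ofFn_get]
  have e2 : (∑ i : Fin L.length, (1 - Real.cos (L.get i))) = (L.map fun t => 1 - Real.cos t).sum := by
    rw [← List.sum_ofFn, ← List.ofFn_get L, List.map_ofFn, List.ofFn_get]
    rfl
  rw [e1, e2, Finset.card_univ, Fintype.card_fin] at h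
  exact h

/-- `ofReal` of a list sum of nonnegative reals. [folklore] -/
theorem ofReal_list_sum_map {α : Type*} (f : α → ℝ) (hf : ∀ a, 0 ≤ f a) :
    ∀ L : List α, ENNReal.ofReal (L.map f).sum = (L.map fun a => ENNReal.ofReal (f a)).sum
  | [] => by simp
  | a :: L => by
    rw [List.map_cons, List.sum_cons, List.map_cons, List.sum_cons,
      ENNReal.ofReal_add (hf a) (List.sum_nonneg (by
        intro x hx
        obtain ⟨b, -, rfl⟩ := List.mem_map.1 hx
        exact hf b)), ofReal_list_sum_map f hf L]

/-- **Lemma 7.3 for the weight `[1 - cos(k·)]` in `ℝ≥0∞`**, list form (the hypothesis `hCl` of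
`DiagramAlgebra.cos_split_theta`). [cite: HeydenreichVanDerHofstad2017, Lemma 7.3 (7.2.16)] -/
theorem cosW_list_sum_le (k : Fin d → ℝ) (L : List (Site d)) :
    cosW k L.sum ≤ L.length * (L.map (cosW k)).sum := by
  have h := one_sub_cos_list_sum_le (L.map (kdot k))
  rw [List.length_map, List.map_map, ← kdot_list_sum] at h
  calc cosW k L.sum = ENNReal.ofReal (1 - Real.cos (kdot k L.sum)) := rfl
    _ ≤ ENNReal.ofReal (L.length * (L.map ((fun t => 1 - Real.cos t) ∘ kdot k)).sum) :=
        ENNReal.ofReal_le_ofReal h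
    _ = L.length * (L.map (cosW k)).sum := by
        rw [ENNReal.ofReal_mul (Nat.cast_nonneg _), ENNReal.ofReal_natCast,
          ofReal_list_sum_map ((fun t => 1 - Real.cos t) ∘ kdot k) (fun a => one_sub_cos_nonneg _)]
        rfl

/-- `τ̃_p = J ⋆ τ_p` in `ℝ≥0∞` (the hypothesis `hTt`). [cite: HeydenreichVanDerHofstad2017, (7.2.3)] -/
theorem tauTildeE_eq_tsum (p : unitInterval) (x : Site d) :
    tauTildeE d p x = ∑' e, ENNReal.ofReal (bondJ d p e) * tauE d p (x - e) := by
  have h := tsum_bondJ_mul_tauE p (0 : Site d) x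
  simp only [sub_zero] at h
  exact h.symm

/-- `Σ_y J(y) ≤ 2dp` in `ℝ≥0∞` (the hypothesis `hJ`). [cite: HeydenreichVanDerHofstad2017, (6.2.1)] -/
theorem tsum_ofReal_bondJ_le (hd : 1 ≤ d) (p : unitInterval) :
    ∑' e, ENNReal.ofReal (bondJ d p e) ≤ ENNReal.ofReal (2 * d * (p : ℝ)) := by
  rw [← ENNReal.ofReal_tsum_of_nonneg (bondJ_nonneg p) (summable_bondJ hd p)]
  exact ENNReal.ofReal_le_ofReal (tsum_bondJ_le hd p)

/-- `τ_p ≤ 1` in `ℝ≥0∞`. [folklore] -/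
theorem tauE_le_one (p : unitInterval) (y : Site d) : tauE d p y ≤ 1 := by
  rw [tauE_def]; exact ENNReal.ofReal_le_one.2 (tau_le_one p 0 y)

/-- `τ̃_p ≤ 2dp` in `ℝ≥0∞`. [cite: HeydenreichVanDerHofstad2017, (7.2.3)] -/
theorem tauTildeE_le (hd : 2 ≤ d) (p : unitInterval) (y : Site d) :
    tauTildeE d p y ≤ ENNReal.ofReal (2 * d * (p : ℝ)) := by
  rw [tauTildeE_def]; exact ENNReal.ofReal_le_ofReal (tauTilde_le hd p y)

/-- `[1 - cos(k·y)] ≤ 2` in `ℝ≥0∞`. [folklore] -/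
theorem cosW_le_two (k : Fin d → ℝ) (y : Site d) : cosW k y ≤ 2 := by
  rw [cosW_def, ← ENNReal.ofReal_ofNat]
  exact ENNReal.ofReal_le_ofReal (by linarith [Real.neg_one_le_cos (kdot k y)])

variable (hd : 2 ≤ d) (p : unitInterval) (hp : (p : ℝ) < criticalProb (zdGraph d) (0 : Site d))

include hd hp in
/-- `Σ_y τ_p(y) < ∞` in `ℝ≥0∞` for `p < p_c`. [cite: AizenmanNewman1984, Prop. 3.1 (χ < ∞ below p_c)] -/
theorem tsum_tauE_ne_top : ∑' y, tauE d p y ≠ ⊤ := by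
  have e : (fun y => tauE d p y) = fun y => ENNReal.ofReal (tau d p 0 y) := rfl
  rw [e, ← ENNReal.ofReal_tsum_of_nonneg (tau_nonneg p 0) (summable_tau_of_lt_criticalProb hd p hp)]
  exact ENNReal.ofReal_ne_top

/-! #### `H_p(k)`: finiteness of `H_p(a₁,a₂;k)` for `p < p_c` and `Hat = ofReal hDiagAt ≤ ofReal hDiag` -/

include hd in
/-- **`H_p(a₁,a₂;k) ≤ 2 (2dp)² χ(p)⁵`** in `ℝ≥0∞` (crude, for finiteness: `[1-cos] ≤ 2`, `τ̃ ≤ 2dp`, `τ ≤ 1`).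
[cite: HeydenreichVanDerHofstad2017, (7.5.1)] -/
theorem Hat_tauE_le (k : Fin d → ℝ) (a₁ a₂ : Site d) :
    Hat (tauE d p) (tauTildeE d p) (cosW k) a₁ a₂ ≤
      2 * (ENNReal.ofReal (2 * d * (p : ℝ)) * ENNReal.ofReal (2 * d * (p : ℝ))) * (∑' y, tauE d p y) ^ 5 := by
  set T := tauE d p with hT
  set S := ∑' y, T y with hS
  set J₀ := ENNReal.ofReal (2 * d * (p : ℝ)) with hJ₀
  have hb : ∀ u v s t : Site d, cosW k (t - u) * B1 T (tauTildeE d p) 0 a₁ u s *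
      B22 T u s s t * B1 T (tauTildeE d p) s t v (v + a₂) ≤
        2 * (J₀ * J₀) * (T u * (T (v - s) * triV T s u t)) := by
    intro u v s t
    have h1 : B1 T (tauTildeE d p) 0 a₁ u s ≤ J₀ * T u := by
      rw [B1_def, sub_zero]; exact mul_le_mul' (tauTildeE_le hd p _) le_rfl
    have h2 : B22 T u s s t ≤ triV T s u t := by
      rw [B22_def, if_pos rfl, one_mul]
      calc T (t - u) * triV T s u t ≤ 1 * triV T s u t := mul_le_mul' (tauE_le_one p _) le_rfl
        _ = triV T s u t := one_mul _
    have h3 : B1 T (tauTildeE d p) s t v (v + a₂) ≤ J₀ * T (v - s) := by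
      rw [B1_def]; exact mul_le_mul' (tauTildeE_le hd p _) le_rfl
    calc cosW k (t - u) * B1 T (tauTildeE d p) 0 a₁ u s * B22 T u s s t * B1 T (tauTildeE d p) s t v (v + a₂)
        ≤ 2 * (J₀ * T u) * triV T s u t * (J₀ * T (v - s)) :=
          mul_le_mul' (mul_le_mul' (mul_le_mul' (cosW_le_two k _) h1) h2) h3
      _ = 2 * (J₀ * J₀) * (T u * (T (v - s) * triV T s u t)) := by ring
  have hS1 : ∀ a : Site d, ∑' t, T (t - a) = S := fun a => by
    rw [hS]; exact DiagramAlgebra.tsum_comp_sub_right T a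
  have hS2 : ∀ a : Site d, ∑' s, T (a - s) = S := fun a => by
    rw [hS]; exact DiagramAlgebra.tsum_comp_sub_left T a
  calc Hat T (tauTildeE d p) (cosW k) a₁ a₂
      ≤ ∑' u, ∑' v, ∑' s, ∑' t, 2 * (J₀ * J₀) * (T u * (T (v - s) * triV T s u t)) := by
        rw [Hat_def]
        exact ENNReal.tsum_le_tsum fun u => ENNReal.tsum_le_tsum fun v => ENNReal.tsum_le_tsum fun s =>
          ENNReal.tsum_le_tsum fun t => hb u v s t
    _ = 2 * (J₀ * J₀) * ∑' u, T u * ∑' v, ∑' s, T (v - s) * ∑' t, triV T s u t := by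
        rw [← ENNReal.tsum_mul_left]
        refine tsum_congr fun u => ?_
        rw [← ENNReal.tsum_mul_left, ← ENNReal.tsum_mul_left]
        refine tsum_congr fun v => ?_
        rw [← ENNReal.tsum_mul_left, ← ENNReal.tsum_mul_left]
        refine tsum_congr fun s => ?_
        rw [← ENNReal.tsum_mul_left, ← ENNReal.tsum_mul_left, ← ENNReal.tsum_mul_left]
    _ = 2 * (J₀ * J₀) * ∑' u, T u * ∑' v, ∑' s, T (v - s) * (S * ∑' a, T (a - s) * T (u - a)) := by
        congr 1
        refine tsum_congr fun u => ?_
        congr 1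
        refine tsum_congr fun v => tsum_congr fun s => ?_
        congr 1
        calc ∑' t, triV T s u t = ∑' t, ∑' a, T (a - s) * T (u - a) * T (t - a) := by simp only [triV_def]
          _ = ∑' a, ∑' t, T (a - s) * T (u - a) * T (t - a) := ENNReal.tsum_comm
          _ = ∑' a, T (a - s) * T (u - a) * S := by
              refine tsum_congr fun a => ?_
              rw [ENNReal.tsum_mul_left, hS1 a]
          _ = S * ∑' a, T (a - s) * T (u - a) := by rw [mul_comm, ← ENNReal.tsum_mul_right]
    _ = 2 * (J₀ * J₀) * ∑' u, T u * (S * (S * (S * S))) := by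
        congr 1
        refine tsum_congr fun u => ?_
        congr 1
        calc ∑' v, ∑' s, T (v - s) * (S * ∑' a, T (a - s) * T (u - a))
            = ∑' s, ∑' v, T (v - s) * (S * ∑' a, T (a - s) * T (u - a)) := ENNReal.tsum_comm
          _ = ∑' s, S * (S * ∑' a, T (a - s) * T (u - a)) := by
              refine tsum_congr fun s => ?_
              rw [ENNReal.tsum_mul_right, hS1 s]
          _ = S * (S * ∑' s, ∑' a, T (a - s) * T (u - a)) := by
              rw [ENNReal.tsum_mul_left, ENNReal.tsum_mul_left]
          _ = S * (S * ∑' a, ∑' s, T (a - s) * T (u - a)) := by rw [ENNReal.tsum_comm]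
          _ = S * (S * ∑' a, S * T (u - a)) := by
              congr 2
              exact tsum_congr fun a => by rw [ENNReal.tsum_mul_right, hS2 a]
          _ = S * (S * (S * S)) := by rw [ENNReal.tsum_mul_left, hS2 u]
    _ = 2 * (J₀ * J₀) * S ^ 5 := by rw [ENNReal.tsum_mul_right, ← hS]; ring

include hd hp in
/-- The real summand `a ↦ τ(a-s) τ(u-a) τ(t-a)` of `B₂⁽²⁾` is summable for `p < p_c`. [folklore] -/
theorem summable_triV_real (s u t : Site d) :
    Summable fun a => tau d p 0 (a - s) * tau d p 0 (u - a) * tau d p 0 (t - a) := by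
  have hτ : Summable fun a => tau d p 0 (a - s) :=
    (summable_tau_of_lt_criticalProb hd p hp).comp_injective (sub_left_injective (b := s))
  refine Summable.of_nonneg_of_le (fun a => mul_nonneg (mul_nonneg (tau_nonneg p 0 _) (tau_nonneg p 0 _))
    (tau_nonneg p 0 _)) (fun a => ?_) hτ
  have h1 : tau d p 0 (u - a) ≤ 1 := tau_le_one p 0 _
  have h2 : tau d p 0 (t - a) ≤ 1 := tau_le_one p 0 _
  calc tau d p 0 (a - s) * tau d p 0 (u - a) * tau d p 0 (t - a)
      ≤ tau d p 0 (a - s) * 1 * 1 :=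
        mul_le_mul (mul_le_mul_of_nonneg_left h1 (tau_nonneg p 0 _)) h2 (tau_nonneg p 0 _)
          (mul_nonneg (tau_nonneg p 0 _) zero_le_one)
    _ = tau d p 0 (a - s) := by ring

/-- `ofReal B₁ = B1 τE τ̃E`. [cite: HeydenreichVanDerHofstad2017, (7.4.3)] -/
theorem ofReal_diagB1 (s t u v : Site d) :
    ENNReal.ofReal (diagB1 d p s t u v) = B1 (tauE d p) (tauTildeE d p) s t u v := by
  rw [diagB1_def, B1_def, ENNReal.ofReal_mul (tauTilde_nonneg p _), tauTildeE_def, tauE_def]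

include hd hp in
/-- `ofReal B₂⁽²⁾ = B22 τE` (for `p < p_c`, where the inner sum converges). [cite: HeydenreichVanDerHofstad2017, (7.4.4)] -/
theorem ofReal_diagB22 (u v s t : Site d) :
    ENNReal.ofReal (diagB22 d p u v s t) = B22 (tauE d p) u v s t := by
  rw [diagB22_def, B22_def]
  by_cases h : v = s
  · rw [if_pos h, if_pos h, one_mul, one_mul, ENNReal.ofReal_mul (tau_nonneg p 0 _), triV_def,
      ENNReal.ofReal_tsum_of_nonneg (fun a => mul_nonneg (mul_nonneg (tau_nonneg p 0 _) (tau_nonneg p 0 _))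
        (tau_nonneg p 0 _)) (summable_triV_real hd p hp s u t), tauE_def]
    congr 1
    exact tsum_congr fun a => by
      rw [ENNReal.ofReal_mul (mul_nonneg (tau_nonneg p 0 _) (tau_nonneg p 0 _)),
        ENNReal.ofReal_mul (tau_nonneg p 0 _), tauE_def, tauE_def, tauE_def]
  · rw [if_neg h, if_neg h]; simp

include hd hp in
/-- **`H_p(a₁,a₂;k)` in `ℝ≥0∞` is `ofReal` of the real `hDiagAt`, and `hDiagAt` is uniformly bounded**
(`p < p_c`). [cite: HeydenreichVanDerHofstad2017, (7.5.1)–(7.5.2)] -/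
theorem Hat_tauE_eq_ofReal_hDiagAt (k : Fin d → ℝ) (a₁ a₂ : Site d) :
    Hat (tauE d p) (tauTildeE d p) (cosW k) a₁ a₂ = ENNReal.ofReal (hDiagAt d p a₁ a₂ k) ∧
      hDiagAt d p a₁ a₂ k ≤ (2 * (ENNReal.ofReal (2 * d * (p : ℝ)) * ENNReal.ofReal (2 * d * (p : ℝ))) *
        (∑' y, tauE d p y) ^ 5).toReal := by
  set g : Site d × Site d × Site d × Site d → ℝ := fun q =>
    (1 - Real.cos (kdot k (q.2.2.2 - q.1))) * diagB1 d p 0 a₁ q.1 q.2.2.1 *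
      diagB22 d p q.1 q.2.2.1 q.2.2.1 q.2.2.2 * diagB1 d p q.2.2.1 q.2.2.2 q.2.1 (q.2.1 + a₂) with hg
  set G : Site d × Site d × Site d × Site d → ℝ≥0∞ := fun q =>
    cosW k (q.2.2.2 - q.1) * B1 (tauE d p) (tauTildeE d p) 0 a₁ q.1 q.2.2.1 *
      B22 (tauE d p) q.1 q.2.2.1 q.2.2.1 q.2.2.2 *
        B1 (tauE d p) (tauTildeE d p) q.2.2.1 q.2.2.2 q.2.1 (q.2.1 + a₂) with hG
  have hg0 : ∀ q, 0 ≤ g q := fun q => hDiagAt_summand_nonneg p a₁ a₂ k q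
  have hgG : ∀ q, ENNReal.ofReal (g q) = G q := by
    intro q
    simp only [hg, hG]
    rw [ENNReal.ofReal_mul (mul_nonneg (mul_nonneg (one_sub_cos_nonneg _) (diagB1_nonneg p _ _ _ _))
      (diagB22_nonneg p _ _ _ _)), ENNReal.ofReal_mul (mul_nonneg (one_sub_cos_nonneg _) (diagB1_nonneg p _ _ _ _)),
      ENNReal.ofReal_mul (one_sub_cos_nonneg _), ofReal_diagB1, ofReal_diagB1, ofReal_diagB22 hd p hp, cosW_def]
  have hHat : Hat (tauE d p) (tauTildeE d p) (cosW k) a₁ a₂ = ∑' q, G q := by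
    rw [Hat_def, ENNReal.tsum_prod']
    refine tsum_congr fun u => ?_
    rw [ENNReal.tsum_prod']
    refine tsum_congr fun v => ?_
    rw [ENNReal.tsum_prod']
  have hfin : ∑' q, G q ≠ ⊤ := by
    rw [← hHat]
    refine ne_top_of_le_ne_top ?_ (Hat_tauE_le hd p k a₁ a₂)
    refine ENNReal.mul_ne_top (ENNReal.mul_ne_top (by simp) (ENNReal.mul_ne_top ENNReal.ofReal_ne_top
      ENNReal.ofReal_ne_top)) (ENNReal.pow_ne_top (tsum_tauE_ne_top hd p hp))
  have hsum : Summable g := by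
    have h := ENNReal.summable_toReal hfin
    have e : (fun q => (G q).toReal) = g := funext fun q => by rw [← hgG, ENNReal.toReal_ofReal (hg0 q)]
    rwa [e] at h
  have hD : hDiagAt d p a₁ a₂ k = ∑' q, g q := hDiagAt_def p a₁ a₂ k
  refine ⟨?_, ?_⟩
  · rw [hD, ENNReal.ofReal_tsum_of_nonneg hg0 hsum, hHat]
    exact tsum_congr fun q => (hgG q).symm
  · rw [hD]
    have e : ∑' q, g q = (∑' q, G q).toReal := by
      rw [ENNReal.tsum_toReal_eq fun q => by rw [← hgG]; exact ENNReal.ofReal_ne_top]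
      exact tsum_congr fun q => by rw [← hgG, ENNReal.toReal_ofReal (hg0 q)]
    rw [e, ← hHat]
    exact ENNReal.toReal_mono (ENNReal.mul_ne_top (ENNReal.mul_ne_top (by simp)
      (ENNReal.mul_ne_top ENNReal.ofReal_ne_top ENNReal.ofReal_ne_top))
      (ENNReal.pow_ne_top (tsum_tauE_ne_top hd p hp))) (Hat_tauE_le hd p k a₁ a₂)

include hd hp in
/-- **`H_p(a₁,a₂;k) ≤ H_p(k)`** for `p < p_c` (the family is bounded, so the real supremum is one).
[cite: HeydenreichVanDerHofstad2017, (7.5.2)] -/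
theorem hDiagAt_le_hDiag (k : Fin d → ℝ) (a₁ a₂ : Site d) : hDiagAt d p a₁ a₂ k ≤ hDiag d p k := by
  rw [hDiag_def]
  exact le_ciSup (f := fun a : Site d × Site d => hDiagAt d p a.1 a.2 k)
    ⟨_, by rintro _ ⟨a, rfl⟩; exact (Hat_tauE_eq_ofReal_hDiagAt hd p hp k a.1 a.2).2⟩ (a₁, a₂)

include hd hp in
/-- The hypothesis `hH`: `Hat ≤ ofReal H_p(k)`. [cite: HeydenreichVanDerHofstad2017, (7.5.1)–(7.5.2)] -/
theorem Hat_tauE_le_ofReal_hDiag (k : Fin d → ℝ) (a₁ a₂ : Site d) :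
    Hat (tauE d p) (tauTildeE d p) (cosW k) a₁ a₂ ≤ ENNReal.ofReal (hDiag d p k) := by
  rw [(Hat_tauE_eq_ofReal_hDiagAt hd p hp k a₁ a₂).1]
  exact ENNReal.ofReal_le_ofReal (hDiagAt_le_hDiag hd p hp k a₁ a₂)

end Hyps


/-! ### Prop. 7.4 -/

section Main

/-- **Prop. 7.4 (Diagrammatic estimates for `N ≥ 1`)** — discharge of the named fact
`HvdH2017_prop74`: for `d ≥ 2`, `p < p_c`, `N ≥ 1`,
`Σ_x Π^{(N)}(x) ≤ Δ_p (2Δ̃_pΔ_p)^N` (7.5.3) and `Σ_x [1 - cos(k·x)] Π^{(N)}(x) ≤ (2N+1)[Δ_p W_p(k)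
(2Δ̃_p + [1+2dp] N Δ_p)(2Δ̃_pΔ_p)^{N-1} + (N-1)(Δ̃_p² W_p(k) + H_p(k)) Δ_p² (2Δ̃_pΔ_p)^{N-2}]` (7.5.4),
with summability. Proof as printed (§7.3–§7.5): the event inclusions (7.3.8)–(7.3.9) through the
coupled expectations (6.2.27) and the BK inequality (`…Prop74Events.lean`, giving (7.4.10) via
`lacePiT_succ_le_chainN`), then the diagrammatic algebra of §7.5 (`…Prop74Algebra.lean`:
(7.5.5)–(7.5.14) and Exercise 7.5 for (7.5.3); Lemma 7.3 along the `2N+1` top lines and cases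
(a)–(c) of §7.5.2 for (7.5.4)), instantiated with `τ = τ_p`, `τ̃ = τ̃_p = J ⋆ τ_p`,
`[1-cos(k·)]`, `Δ = Δ_p`, `Δ̃ = Δ̃_p`, `W = W_p(k)`, `H = H_p(k)`, `ΣJ = 2dp`.
[cite: HeydenreichVanDerHofstad2017, Prop. 7.4 ((7.5.3)–(7.5.4)), §7.3–§7.5] -/
theorem HvdH2017_prop74_holds : HvdH2017_prop74 := by
  intro d hd p hp N hN
  obtain ⟨n, rfl⟩ : ∃ n, N = n + 1 := ⟨N - 1, by omega⟩
  set Δ := triangleDiag d p with hΔdef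
  set Δt := triangleTildeDiag d p with hΔtdef
  have hΔ0 : 0 ≤ Δ := triangleDiag_nonneg p
  have hΔt0 : 0 ≤ Δt := triangleTildeDiag_nonneg p
  have hq0 : (0 : ℝ) ≤ 2 * d * (p : ℝ) := by have := p.2.1; positivity
  -- hypotheses of the diagram algebra
  have hT0 : tauE d p 0 = 1 := tauE_zero p
  have hTs : ∀ x : Site d, tauE d p (-x) = tauE d p x := tauE_neg p
  have hTts : ∀ x : Site d, tauTildeE d p (-x) = tauTildeE d p x := tauTildeE_neg p
  have hD : ∀ x, convE (convE (tauE d p) (tauE d p)) (tauE d p) x ≤ ENNReal.ofReal Δ := fun x => by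
    rw [convE_convE_tauE_eq_triangleAt hd p hp]
    exact ENNReal.ofReal_le_ofReal (triangleAt_le_triangleDiag hd p hp x)
  have hDt : ∀ x, convE (convE (tauE d p) (tauE d p)) (tauTildeE d p) x ≤ ENNReal.ofReal Δt := fun x => by
    rw [convE_convE_tauTildeE_eq_triangleTildeAt hd p hp]
    exact ENNReal.ofReal_le_ofReal (triangleTildeAt_le_triangleTildeDiag hd p hp x)
  -- (7.5.3) in `ℝ≥0∞`
  have h53 : ∑' x, lacePiT d p (n + 1) x ≤
      ENNReal.ofReal Δ * (2 * ENNReal.ofReal Δt * ENNReal.ofReal Δ) ^ (n + 1) :=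
    (ENNReal.tsum_le_tsum fun x => lacePiT_succ_le_chainN p n x).trans
      (tsum_chainN_le_closed hT0 hTs hTts hD hDt n)
  set a : ℝ≥0 := Δ.toNNReal with hadef
  set b : ℝ≥0 := Δt.toNNReal with hbdef
  have ea : ENNReal.ofReal Δ = (a : ℝ≥0∞) := rfl
  have eb : ENNReal.ofReal Δt = (b : ℝ≥0∞) := rfl
  have h53' : ∑' x, lacePiT d p (n + 1) x ≤ ((a * (2 * b * a) ^ (n + 1) : ℝ≥0) : ℝ≥0∞) := by
    rw [ea, eb] at h53
    push_cast
    exact h53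
  have hfin : ∑' x, lacePiT d p (n + 1) x ≠ ⊤ := ne_top_of_le_ne_top ENNReal.coe_ne_top h53'
  have hfinx : ∀ x, lacePiT d p (n + 1) x ≠ ⊤ := fun x => ne_top_of_le_ne_top hfin (ENNReal.le_tsum x)
  have hPi : ∀ x : Site d, lacePi d p (n + 1) x = (lacePiT d p (n + 1) x).toReal := fun x =>
    lacePi_of_ne (Or.inl (Nat.succ_ne_zero n))
  have hsum : Summable (lacePi d p (n + 1)) := by
    rw [show lacePi d p (n + 1) = fun x => (lacePiT d p (n + 1) x).toReal from funext hPi]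
    exact ENNReal.summable_toReal hfin
  refine ⟨⟨hsum, ?_⟩, fun k => ⟨?_, ?_⟩⟩
  · -- (7.5.3)
    calc ∑' x, lacePi d p (n + 1) x = ∑' x, (lacePiT d p (n + 1) x).toReal := tsum_congr hPi
      _ = (∑' x, lacePiT d p (n + 1) x).toReal := (ENNReal.tsum_toReal_eq hfinx).symm
      _ ≤ (((a * (2 * b * a) ^ (n + 1) : ℝ≥0) : ℝ≥0∞)).toReal := ENNReal.toReal_mono ENNReal.coe_ne_top h53'
      _ = Δ * (2 * Δt * Δ) ^ (n + 1) := by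
          rw [ENNReal.coe_toReal]
          push_cast
          rw [Real.coe_toNNReal Δ hΔ0, Real.coe_toNNReal Δt hΔt0]
  · -- summability of the weighted coefficient
    refine Summable.of_nonneg_of_le (fun x => mul_nonneg (one_sub_cos_nonneg _) (lacePi_nonneg p _ x))
      (fun x => ?_) (hsum.mul_left 2)
    exact mul_le_mul_of_nonneg_right (by linarith [Real.neg_one_le_cos (kdot k x)]) (lacePi_nonneg p _ x)
  · -- (7.5.4)
    set W := wDiag d p k with hWdef
    set H := hDiag d p k with hHdef
    have hW0 : 0 ≤ W := wDiag_nonneg p k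
    have hH0 : 0 ≤ H := hDiag_nonneg p k
    have hW : ∀ y, convE (fun s => cosW k s * tauTildeE d p s) (tauE d p) y ≤ ENNReal.ofReal W := fun y => by
      rw [convE_cosW_eq_wDiagAt hd p hp]
      exact ENNReal.ofReal_le_ofReal (wDiagAt_le_wDiag hd p hp (-y) k)
    have hH : ∀ a₁ a₂, Hat (tauE d p) (tauTildeE d p) (cosW k) a₁ a₂ ≤ ENNReal.ofReal H :=
      Hat_tauE_le_ofReal_hDiag hd p hp k
    have h54 := tsum_cos_chainN_le_closed (T := tauE d p) (Tt := tauTildeE d p) (C := cosW k)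
      (D := ENNReal.ofReal Δ) (Dt := ENNReal.ofReal Δt) (W := ENNReal.ofReal W) (H := ENNReal.ofReal H)
      (J₀ := ENNReal.ofReal (2 * d * (p : ℝ))) (Jf := fun e => ENNReal.ofReal (bondJ d p e))
      hT0 hTs hTts (cosW_list_sum_le k) (cosW_zero k) (cosW_mul_tauE_le p k) (tauTildeE_eq_tsum p)
      (tsum_ofReal_bondJ_le (by omega) p) hD hDt hW hH n
    have hle : ∑' x, cosW k x * lacePiT d p (n + 1) x ≤ _ :=
      (ENNReal.tsum_le_tsum fun x => mul_le_mul' le_rfl (lacePiT_succ_le_chainN p n x)).trans h54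
    set w : ℝ≥0 := W.toNNReal with hwdef
    set h : ℝ≥0 := H.toNNReal with hhdef
    set j : ℝ≥0 := (2 * d * (p : ℝ)).toNNReal with hjdef
    have ew : ENNReal.ofReal W = (w : ℝ≥0∞) := rfl
    have eh : ENNReal.ofReal H = (h : ℝ≥0∞) := rfl
    have ej : ENNReal.ofReal (2 * d * (p : ℝ)) = (j : ℝ≥0∞) := rfl
    set e : ℝ≥0 := (2 * n + 3) * (2 * a * b * w * (2 * b * a) ^ n +
      (n + 1) * (1 + j) * a ^ 2 * w * (2 * b * a) ^ n + n * (b ^ 2 * w + h) * a ^ 2 * (2 * b * a) ^ (n - 1))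
      with hedef
    have hle' : ∑' x, cosW k x * lacePiT d p (n + 1) x ≤ (e : ℝ≥0∞) := by
      rw [ea, eb, ew, eh, ej] at hle
      refine hle.trans_eq ?_
      rw [hedef]
      push_cast
      ring
    have hconv : ∑' x, (1 - Real.cos (kdot k x)) * lacePi d p (n + 1) x =
        (∑' x, cosW k x * lacePiT d p (n + 1) x).toReal := by
      rw [ENNReal.tsum_toReal_eq (f := fun x => cosW k x * lacePiT d p (n + 1) x) fun x =>
        ENNReal.mul_ne_top (by rw [cosW_def]; exact ENNReal.ofReal_ne_top) (hfinx x)]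
      exact tsum_congr fun x => by
        rw [hPi, ENNReal.toReal_mul, cosW_def, ENNReal.toReal_ofReal (one_sub_cos_nonneg _)]
    rw [hconv]
    refine (ENNReal.toReal_mono ENNReal.coe_ne_top hle').trans (le_of_eq ?_)
    rw [ENNReal.coe_toReal, hedef]
    push_cast
    rw [Real.coe_toNNReal Δ hΔ0, Real.coe_toNNReal Δt hΔt0, Real.coe_toNNReal W hW0, Real.coe_toNNReal H hH0,
      Real.coe_toNNReal _ hq0]
    ring

end Main

end Literature.Barriers.CriticalPhenomena

end
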